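import Summits.QuantumFields.YangMills.Theorems.UnitScaleTiltProp7GreenKernelSiteTransport
import Summits.QuantumFields.YangMills.Theorems.UnitScaleTiltProp7TorusGreenHessianDecay
import Summits.QuantumFields.YangMills.Theorems.UnitScaleTiltProp7TorusGreen2HessianDecay
import Literature.MathematicalPhysics.QuantumFieldTheory.BalabanImbrieJaffe1984to88.BIJ85Prop12TorusBridgeGeom
import Summits.QuantumFields.YangMills.Theorems.UnitScaleTiltProp7NearFieldGreenGradientSum
import HarnessLib

/-!
# Route `UnitScaleTilt`, crux K1 «MinimiserStabilityRegPr» (stmt-QuantumFields-19200), route-R E′ path (α′), residue (hK), row (R5) part 2: THE GREEN-FUNCTION ROWS IN `Site P 0`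
# LETTERS — the `d = 3` gradient decay (N) ✓ `torusGreen_grad_mul_dist_sq_le` and Hessian decay ✓ `torusGreen_hessian_mul_dist_cube_le` of the torus Green function read on the free
# kernel differences of ✓ `Prop7GreenKernelSiteTransport.exists_green_site_split` (arguments `EK z − EK x` along a bond ∕ two bonds of the finest torus), with constants UNIFORM in
# the volume, and the comparison `tdist(z,x)² ≤ d·Σ_μ z̃_μ²` between the record's ℓ¹ torus distance `Site.tdist` and the centred ℓ² distance under `EK`

Cell `ym3-torus`, width seat `ym3-torus-px4` (gen 2); ★ym-routeR-w3 g5 19:28:35Z (R5) + 19:41:59Z «Part 2 GO as described (the `tdist² ≤ d·Σ valMinAbs²` comparison is the right extra)».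
THEOREMS ONLY (0 `def`, 0 `sorry`); `--supports stmt-QuantumFields-19200`, count-neutral.  YM₃ on T³ is a ladder rung (R3), not the Clay problem; nothing here claims the stub, the
crux, d = 4 or the gap.

WHAT IS PROVED (ns `…Theorems.Prop7GreenKernelSiteRows`).
* §1 `d`-WRAPPERS with the constant fixed BEFORE the dimension (so `hd : P.d = 3` instantiates with no `Fin` cast and the constant stays volume-uniform):
  `torusGreen_grad_mul_dist_sq_le_of_eq : ∃ C, ∀ {d} (hd : d = 3) L i (z : TorusSite d L), z ≠ 0 → |G̃(z+eᵢ) − G̃(z)|·Σ_μz̃_μ² ≤ C`, `torusGreen_hessian_mul_dist_cube_le_of_eq` (idem, `·(Σz̃²)^{3∕2}`).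
* §2 SITE ROWS (constants uniform in `P`, `k`): ★★ `exists_free_kernel_grad_const` — `∃ C, ∀ P (hd : P.d = 3) k (hk) (x z : Site P 0) μ, z ≠ x+e_μ →
  |G̃(EK z − EK x) − G̃(EK z − EK(x+e_μ))|·Σ_ν ((EK z − EK(x+e_μ)) ν)̃² ≤ C` (the bond difference of `laplace c (Gf ·) z` of part 1 is `(2c²)⁻¹` times this, the `y_c`-term
  cancelling), ★ `exists_free_kernel_hessian_const` (the two-bond second difference, base point `EK z − EK(x+eᵢ−eⱼ)`, weight `(Σ z̃²)^{3∕2}`).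
* §3 DISTANCES (via ✓ `BIJ85Prop12TorusBridgeGeom.min_val_neg_val`∕`valMinAbs_EK_sub`): ★ `tdist_eq_sum_abs_valMinAbs_EK` (`tdist z x = Σ_μ |((EK z − EK x) μ)̃|`, the record's ℓ¹
  torus distance IS the ℓ¹ norm of the centred coordinates under `EK`), ★ `tdist_sq_le_card_mul_sum_sq` (`tdist(z,x)² ≤ d·Σ_μ ((EK z − EK x) μ)̃²`, Cauchy–Schwarz) — so every
  row above also holds with the weight `tdist(z,·)²∕d` (resp. `tdist³∕d^{3∕2}`) in routeR-w2's (W)-letters.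
* §4 (v1.1) THE NEAR-FIELD BALL SUM IN `Site P 0` LETTERS (px7's (R4) ✓ `Prop7NearFieldGreenGradientSum.sum_ball_abs_torusGreen_grad_le` transported): `sum_ball_abs_torusGreen_grad_le_of_eq`
  (dimension parameter), `supDist_le_iff_EK` (the record's ℓ^∞ distance `supDist` IS the sup of the centred coordinates under `EK`), ★★ `exists_free_kernel_grad_ball_sum_const` —
  `∃ C ≥ 0, ∀ P (hd : P.d = 3) k hk x μ R, 2R < L^k·sitesPerDir k → Σ_{z : supDist z (x+e_μ) ≤ R} |G̃(EK z − EK x) − G̃(EK z − EK(x+e_μ))| ≤ C·(R+1)` (A2 on the finest torus).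
* §5 (v1.2) (R5c-rows) for the FREE KERNEL `Gf` of ✓ `Prop7GreenKernelSiteFree.exists_green_site_split_free` (any `Gf` with `Gf x z = (4c⁴)⁻¹(G₂(EK z − EK x) − G₂(EK z − EK y_c))`, `G₂` in the
  displayed `hG` currency of ✓ `Prop7TorusGreen2HessianDecay`): `green2_hessian_mul_dist_le_of_eq` ((R3a) ✓ `hessian_mul_dist_le` with the dimension as a parameter),
  ★ `abs_free_sub_free_le_of_grad_bound` (`|Gf (x+e_μ) z − Gf x z| ≤ C_V∕(4c⁴)` ⟸ the DISPLAYED (R2) row `|G̃₂(t+eᵢ) − G̃₂(t)| ≤ C_V`), ★★ `exists_grad_free_sub_free_const`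
  (`|(Gf (x+e_μ) (z+e_ν) − Gf x (z+e_ν)) − (Gf (x+e_μ) z − Gf x z)|·√(Σ((EK z − EK x) ν′)̃²) ≤ C∕(4c⁴)` for `z ≠ x`, C uniform in `P, k, c`).
HONEST SCOPE.  Re-lettering only; the analysis is ✓p659194 (★routeR-w3 g5), ✓p661087 (ym-routeR-w6 g5), ✓p662443 (px7 g2) and ✓p662426 (★w8-19200 g7).

References: G. F. Lawler, V. Limic, *Random Walk: A Modern Introduction*, CUP 2010, Thm 4.3.1, §6.3 [LawlerLimic2010]; T. Bałaban, CMP 95 (1984) 17–40 [Balaban1984PropagatorsI]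
((1.17)–(1.21) pp.20–21); CMP 99 (1985) 75–102 [Balaban1985RegularSpaces] ((1.36) p.82).
-/

set_option autoImplicit false

noncomputable section

open scoped BigOperators
open Finset

namespace Summit.QuantumFields.YangMills.Theorems.Prop7GreenKernelSiteRows

open Literature.MathematicalPhysics.QuantumFieldTheory.Balaban1983to89
open LatticeFieldCalculus
open B5Prop11Plancherel (Tor fine unitVec)
open B5Eq117TorusCarriers (Mk EK EK_apply)
open Literature.Probability.LatticeModels (torusGreen TorusSite)
open Literature.MathematicalPhysics.QuantumFieldTheory.BalabanImbrieJaffe1984to88.BIJ85Thm711TorusTransport (EK_shift)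
open Prop7CentreHarmonicDivDictionary (EK_unshift)
open Literature.MathematicalPhysics.QuantumFieldTheory.BalabanImbrieJaffe1984to88.BIJ85Prop12TorusBridgeGeom (min_val_neg_val valMinAbs_EK_sub supDist_eq_sup_natAbs)

/-! ## §1 The `d = 3` rows with the constant fixed before the dimension -/

/-- (N) with a dimension PARAMETER: `∃ C, ∀ d = 3, ∀ L i z ≠ 0, |G̃(z+eᵢ) − G̃(z)|·Σ_μz̃_μ² ≤ C` (✓ `torusGreen_grad_mul_dist_sq_le`). [cite: Balaban1985RegularSpaces, (1.36) p.82] -/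
theorem torusGreen_grad_mul_dist_sq_le_of_eq : ∃ C : ℝ, ∀ {d : ℕ} (_ : d = 3) (L : ℕ) [NeZero L] (i : Fin d) (z : TorusSite d L), z ≠ 0 →
    |torusGreen (z + Pi.single i 1) - torusGreen z| * (∑ k, (((z k).valMinAbs : ℤ) : ℝ) ^ 2) ≤ C := by
  obtain ⟨C, hC⟩ := Prop7TorusGreenGradientDecay.torusGreen_grad_mul_dist_sq_le
  refine ⟨C, ?_⟩
  intro d hd
  subst hd
  exact hC

/-- (Hess3) with a dimension PARAMETER: `∃ C, ∀ d = 3, ∀ L i j z ≠ 0, |∇ᵢ⁺∇ⱼ⁻G̃(z)|·(Σ_μz̃_μ²)^{3∕2} ≤ C` (✓ `torusGreen_hessian_mul_dist_cube_le`). [cite: Balaban1985RegularSpaces, (1.36) p.82] -/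
theorem torusGreen_hessian_mul_dist_cube_le_of_eq : ∃ C : ℝ, ∀ {d : ℕ} (_ : d = 3) (L : ℕ) [NeZero L] (i j : Fin d) (z : TorusSite d L), z ≠ 0 →
    |torusGreen (z + Pi.single i 1) - torusGreen (z + Pi.single i 1 - Pi.single j 1) - torusGreen z + torusGreen (z - Pi.single j 1)| *
      Real.sqrt (∑ k, (((z k).valMinAbs : ℤ) : ℝ) ^ 2) ^ 3 ≤ C := by
  obtain ⟨C, hC⟩ := Prop7TorusGreenHessianDecay.torusGreen_hessian_mul_dist_cube_le
  refine ⟨C, ?_⟩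
  intro d hd
  subst hd
  exact hC

/-! ## §2 The free-kernel rows in `Site P 0` letters -/

/-- `EK z − EK x = (EK z − EK (x + e_μ)) + e_μ`. [cite: Balaban1984PropagatorsI, (1.17) p.20] -/
theorem EK_sub_eq_sub_shift_add {P : Params} {k : ℕ} (hk : k ≤ P.m + P.K) (z x : Site P 0) (μ : Fin P.d) :
    EK hk z - EK hk x = (EK hk z - EK hk (x.shift μ)) + Pi.single μ 1 := by
  have h : EK hk (x.shift μ) = EK hk x + unitVec (fine (P.L ^ k) (Mk P k)) μ := EK_shift hk x μ
  rw [h]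
  show EK hk z - EK hk x = EK hk z - (EK hk x + Pi.single μ 1) + Pi.single μ 1
  abel

/-- `EK z − EK (x − e_j) = (EK z − EK x) + e_j`. [cite: Balaban1984PropagatorsI, (1.17) p.20] -/
theorem EK_sub_unshift_eq {P : Params} {k : ℕ} (hk : k ≤ P.m + P.K) (z x : Site P 0) (j : Fin P.d) :
    EK hk z - EK hk (x.unshift j) = (EK hk z - EK hk x) + Pi.single j 1 := by
  have h : EK hk (x.unshift j) = EK hk x - unitVec (fine (P.L ^ k) (Mk P k)) j := EK_unshift hk x j
  rw [h]
  show EK hk z - (EK hk x - Pi.single j 1) = EK hk z - EK hk x + Pi.single j 1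
  abel

/-- ★★ **THE GRADIENT ROW OF THE FREE KERNEL IN `Site P 0` LETTERS** (`d = 3`, constant uniform in `P`, `k`): for `z ≠ x + e_μ`,
`|G̃(EK z − EK x) − G̃(EK z − EK(x+e_μ))|·Σ_ν ((EK z − EK(x+e_μ)) ν)̃² ≤ C` — by part 1's `laplace c (Gf x) z = (2c²)⁻¹(G̃(EK z − EK x) − G̃(EK z − EK y_c))` the bond difference
`laplace c (Gf b.src) z − laplace c (Gf b.tgt) z` is `(2c²)⁻¹` times the left factor. [cite: Balaban1985RegularSpaces, (1.36) p.82] -/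
theorem exists_free_kernel_grad_const : ∃ C : ℝ, ∀ (P : Params) (_ : P.d = 3) (k : ℕ) (hk : k ≤ P.m + P.K)
    (x z : Site P 0) (μ : Fin P.d), z ≠ x.shift μ →
      |torusGreen (L := P.L ^ k * P.sitesPerDir k) (EK hk z - EK hk x)
          - torusGreen (L := P.L ^ k * P.sitesPerDir k) (EK hk z - EK hk (x.shift μ))| *
        (∑ ν, ((((EK hk z - EK hk (x.shift μ)) ν).valMinAbs : ℤ) : ℝ) ^ 2) ≤ C := by
  obtain ⟨C, hC⟩ := torusGreen_grad_mul_dist_sq_le_of_eq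
  refine ⟨C, ?_⟩
  intro P hd k hk x z μ hz
  haveI : NeZero (P.L ^ k * P.sitesPerDir k) := ⟨mul_ne_zero (pow_ne_zero _ P.L_pos.ne') (P.sitesPerDir_ne_zero k)⟩
  have ht : (EK hk z - EK hk (x.shift μ) : TorusSite P.d (P.L ^ k * P.sitesPerDir k)) ≠ 0 := by
    intro h
    apply hz
    exact (EK hk).injective (sub_eq_zero.1 h)
  have h := hC hd (P.L ^ k * P.sitesPerDir k) μ (EK hk z - EK hk (x.shift μ)) ht
  rwa [← EK_sub_eq_sub_shift_add hk z x μ] at h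

/-- ★ **THE HESSIAN ROW OF THE FREE KERNEL IN `Site P 0` LETTERS** (`d = 3`, constant uniform in `P`, `k`): the two-bond second difference of `x ↦ G̃(EK z − EK x)` (forward in `i`,
backward in `j`), weighted by the cubed ℓ² distance at the base point `EK z − EK(x + eᵢ − eⱼ)`, is bounded. [cite: Balaban1985RegularSpaces, (1.36) p.82] -/
theorem exists_free_kernel_hessian_const : ∃ C : ℝ, ∀ (P : Params) (_ : P.d = 3) (k : ℕ) (hk : k ≤ P.m + P.K)
    (x z : Site P 0) (i j : Fin P.d), z ≠ (x.shift i).unshift j →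
      |torusGreen (L := P.L ^ k * P.sitesPerDir k) (EK hk z - EK hk (x.shift i))
          - torusGreen (L := P.L ^ k * P.sitesPerDir k) (EK hk z - EK hk ((x.shift i).unshift j))
          - torusGreen (L := P.L ^ k * P.sitesPerDir k) (EK hk z - EK hk x)
          + torusGreen (L := P.L ^ k * P.sitesPerDir k) (EK hk z - EK hk (x.unshift j))| *
        Real.sqrt (∑ ν, ((((EK hk z - EK hk ((x.shift i).unshift j)) ν).valMinAbs : ℤ) : ℝ) ^ 2) ^ 3 ≤ C := by
  obtain ⟨C, hC⟩ := torusGreen_hessian_mul_dist_cube_le_of_eq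
  refine ⟨C, ?_⟩
  intro P hd k hk x z i j hz
  haveI : NeZero (P.L ^ k * P.sitesPerDir k) := ⟨mul_ne_zero (pow_ne_zero _ P.L_pos.ne') (P.sitesPerDir_ne_zero k)⟩
  set t : TorusSite P.d (P.L ^ k * P.sitesPerDir k) := EK hk z - EK hk ((x.shift i).unshift j) with ht'
  have ht : t ≠ 0 := by
    intro h
    apply hz
    exact (EK hk).injective (sub_eq_zero.1 h)
  have h := hC hd (P.L ^ k * P.sitesPerDir k) i j t ht
  -- the four arguments: `t + eᵢ = EK z − EK(x − eⱼ)`, `t + eᵢ − eⱼ = EK z − EK x`, `t − eⱼ = EK z − EK(x + eᵢ)`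
  have hsi : (EK hk (x.shift i) : TorusSite P.d (P.L ^ k * P.sitesPerDir k)) = EK hk x + Pi.single i 1 := EK_shift hk x i
  have hus : (EK hk ((x.shift i).unshift j) : TorusSite P.d (P.L ^ k * P.sitesPerDir k)) = EK hk x + Pi.single i 1 - Pi.single j 1 := by
    rw [show (EK hk ((x.shift i).unshift j) : TorusSite P.d (P.L ^ k * P.sitesPerDir k)) = EK hk (x.shift i) - Pi.single j 1 from
      EK_unshift hk (x.shift i) j, hsi]
  have huj : (EK hk (x.unshift j) : TorusSite P.d (P.L ^ k * P.sitesPerDir k)) = EK hk x - Pi.single j 1 := EK_unshift hk x j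
  have e1 : t + Pi.single i 1 - Pi.single j 1 = EK hk z - EK hk x := by rw [ht', hus]; abel
  have e2 : t + Pi.single i 1 = EK hk z - EK hk (x.unshift j) := by rw [ht', hus, huj]; abel
  have e3 : t - Pi.single j 1 = EK hk z - EK hk (x.shift i) := by rw [ht', hus, hsi]; abel
  rw [e1, e2, e3] at h
  have eabs : |torusGreen (L := P.L ^ k * P.sitesPerDir k) (EK hk z - EK hk (x.unshift j))
        - torusGreen (L := P.L ^ k * P.sitesPerDir k) (EK hk z - EK hk x)
        - torusGreen (L := P.L ^ k * P.sitesPerDir k) t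
        + torusGreen (L := P.L ^ k * P.sitesPerDir k) (EK hk z - EK hk (x.shift i))|
      = |torusGreen (L := P.L ^ k * P.sitesPerDir k) (EK hk z - EK hk (x.shift i))
          - torusGreen (L := P.L ^ k * P.sitesPerDir k) t
          - torusGreen (L := P.L ^ k * P.sitesPerDir k) (EK hk z - EK hk x)
          + torusGreen (L := P.L ^ k * P.sitesPerDir k) (EK hk z - EK hk (x.unshift j))| := by
    congr 1; ring
  rwa [eabs] at h

/-! ## §3 The record's ℓ¹ torus distance against the centred ℓ² distance under `EK` -/

/-- ★ **`tdist` IS THE ℓ¹ NORM OF THE CENTRED COORDINATES UNDER `EK`**: `tdist z x = Σ_μ |((EK z − EK x) μ)̃|`. [cite: Balaban1984PropagatorsI, (1.17) p.20] -/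
theorem tdist_eq_sum_abs_valMinAbs_EK {P : Params} {k : ℕ} (hk : k ≤ P.m + P.K) (z x : Site P 0) :
    (Site.tdist z x : ℤ) = ∑ μ, |(((EK hk z - EK hk x) μ).valMinAbs : ℤ)| := by
  unfold Site.tdist
  rw [Nat.cast_sum]
  refine Finset.sum_congr rfl fun μ _ => ?_
  rw [show x μ - z μ = -(z μ - x μ) from (neg_sub _ _).symm, min_val_neg_val, Int.natCast_natAbs, Pi.sub_apply,
    valMinAbs_EK_sub]

/-- ★ **`tdist(z,x)² ≤ d·Σ_μ ((EK z − EK x) μ)̃²`** (Cauchy–Schwarz): the rows of §2 also hold with the weights `tdist²∕d`, `tdist³∕d^{3∕2}`. [cite: Balaban1984PropagatorsI, (1.17) p.20] -/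
theorem tdist_sq_le_card_mul_sum_sq {P : Params} {k : ℕ} (hk : k ≤ P.m + P.K) (z x : Site P 0) :
    ((Site.tdist z x : ℕ) : ℝ) ^ 2 ≤ (P.d : ℝ) * ∑ μ, ((((EK hk z - EK hk x) μ).valMinAbs : ℤ) : ℝ) ^ 2 := by
  have h1 : ((Site.tdist z x : ℕ) : ℝ) = ∑ μ, |((((EK hk z - EK hk x) μ).valMinAbs : ℤ) : ℝ)| := by
    have h := tdist_eq_sum_abs_valMinAbs_EK hk z x
    have h' : (((Site.tdist z x : ℕ) : ℤ) : ℝ) = ((∑ μ, |(((EK hk z - EK hk x) μ).valMinAbs : ℤ)| : ℤ) : ℝ) := by rw [h]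
    push_cast at h'
    exact h'
  rw [h1]
  have h2 := sq_sum_le_card_mul_sum_sq (s := (Finset.univ : Finset (Fin P.d))) (f := fun μ => |((((EK hk z - EK hk x) μ).valMinAbs : ℤ) : ℝ)|)
  simp only [Finset.card_univ, Fintype.card_fin, sq_abs] at h2
  exact h2


/-! ## §4 The near-field ball sum (px7's (R4)) in `Site P 0` letters (v1.1) -/

/-- (R4) with a dimension PARAMETER: `∃ C ≥ 0, ∀ d = 3, ∀ L i R, 2R < L → Σ_{z : ∀μ |z̃_μ| ≤ R} |G̃(z+eᵢ) − G̃(z)| ≤ C·(R+1)` (✓ `sum_ball_abs_torusGreen_grad_le`).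
[cite: Balaban1985RegularSpaces, (1.36) p.82] -/
theorem sum_ball_abs_torusGreen_grad_le_of_eq : ∃ C : ℝ, 0 ≤ C ∧ ∀ {d : ℕ} (_ : d = 3) (L : ℕ) [NeZero L] (i : Fin d) (R : ℕ), 2 * (R : ℤ) < L →
    ∑ z ∈ (Finset.univ : Finset (TorusSite d L)).filter (fun z => ∀ μ, (z μ).valMinAbs.natAbs ≤ R),
      |torusGreen (z + Pi.single i 1) - torusGreen z| ≤ C * ((R : ℝ) + 1) := by
  obtain ⟨C, hC0, hC⟩ := Prop7NearFieldGreenGradientSum.sum_ball_abs_torusGreen_grad_le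
  refine ⟨C, hC0, ?_⟩
  intro d hd
  subst hd
  exact hC

/-- **the record's ℓ^∞ distance under `EK`**: `supDist z a ≤ R ↔ ∀ ν, |((EK z − EK a) ν)̃| ≤ R` (✓ `BIJ85Prop12TorusBridgeGeom.supDist_eq_sup_natAbs`∕`valMinAbs_EK_sub`).
[cite: Balaban1984PropagatorsI, (1.17) p.20] -/
theorem supDist_le_iff_EK {P : Params} {k : ℕ} (hk : k ≤ P.m + P.K) (z a : Site P 0) (R : ℕ) :
    supDist z a ≤ R ↔ ∀ ν, (((EK hk z - EK hk a) ν).valMinAbs).natAbs ≤ R := by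
  rw [supDist_eq_sup_natAbs, Finset.sup_le_iff]
  simp only [Finset.mem_univ, true_implies, Pi.sub_apply, valMinAbs_EK_sub]

/-- ★★ **THE NEAR-FIELD BALL SUM OF THE FREE KERNEL IN `Site P 0` LETTERS** (`d = 3`, constant uniform in `P`, `k`): for every site `x`, direction `μ` and radius `R` with
`2R < L^k·sitesPerDir k`,  `Σ_{z : supDist z (x+e_μ) ≤ R} |G̃(EK z − EK x) − G̃(EK z − EK(x+e_μ))| ≤ C·(R+1)`  — px7's A2 brick read on the finest torus through the bijection
`z ↦ EK z − EK(x+e_μ)`. [cite: Balaban1985RegularSpaces, (1.36) p.82] -/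
theorem exists_free_kernel_grad_ball_sum_const : ∃ C : ℝ, 0 ≤ C ∧ ∀ (P : Params) (_ : P.d = 3) (k : ℕ) (hk : k ≤ P.m + P.K)
    (x : Site P 0) (μ : Fin P.d) (R : ℕ), 2 * (R : ℤ) < ((P.L ^ k * P.sitesPerDir k : ℕ) : ℤ) →
      ∑ z ∈ (Finset.univ : Finset (Site P 0)).filter (fun z => supDist z (x.shift μ) ≤ R),
        |torusGreen (L := P.L ^ k * P.sitesPerDir k) (EK hk z - EK hk x)
          - torusGreen (L := P.L ^ k * P.sitesPerDir k) (EK hk z - EK hk (x.shift μ))| ≤ C * ((R : ℝ) + 1) := by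
  classical
  obtain ⟨C, hC0, hC⟩ := sum_ball_abs_torusGreen_grad_le_of_eq
  refine ⟨C, hC0, ?_⟩
  intro P hd k hk x μ R hR
  haveI : NeZero (P.L ^ k * P.sitesPerDir k) := ⟨mul_ne_zero (pow_ne_zero _ P.L_pos.ne') (P.sitesPerDir_ne_zero k)⟩
  have h := hC hd (P.L ^ k * P.sitesPerDir k) μ R hR
  -- reindex the site sum by `z ↦ EK z − EK (x + e_μ)`
  set e : Site P 0 ≃ TorusSite P.d (P.L ^ k * P.sitesPerDir k) := (EK hk).trans (Equiv.subRight (EK hk (x.shift μ))) with he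
  have he' : ∀ z, e z = EK hk z - EK hk (x.shift μ) := fun z => rfl
  rw [Finset.sum_equiv e (t := (Finset.univ : Finset (TorusSite P.d (P.L ^ k * P.sitesPerDir k))).filter
      (fun t => ∀ ν, (t ν).valMinAbs.natAbs ≤ R))
      (g := fun t => |torusGreen (L := P.L ^ k * P.sitesPerDir k) (t + Pi.single μ 1) - torusGreen (L := P.L ^ k * P.sitesPerDir k) t|)]
  · exact h
  · intro z
    simp only [Finset.mem_filter, Finset.mem_univ, true_and, he', supDist_le_iff_EK hk]
  · intro z _
    rw [he', ← EK_sub_eq_sub_shift_add hk z x μ]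

section RowsV12

open Literature.Probability.LatticeModels (latticeMomentum dispersion)

variable {P : Params} {k : ℕ}

/-! ## §5 (R5c-rows, v1.2) The bond differences of the free kernel `Gf` of ✓ `Prop7GreenKernelSiteFree.exists_green_site_split_free` through (R2) and (R3a) -/

/-- (R3a) ✓ `Prop7TorusGreen2HessianDecay.hessian_mul_dist_le` with the dimension as a PARAMETER (constant fixed before `d`; `hd : P.d = 3` instantiates without a `Fin` cast).
[cite: Balaban1985RegularSpaces, (1.36) p.82] -/
theorem green2_hessian_mul_dist_le_of_eq : ∃ C : ℝ, ∀ {d : ℕ} (_ : d = 3) (L : ℕ) [NeZero L] (G : TorusSite d L → ℝ),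
    (∀ z, G z = (∑ q ∈ (univ : Finset (TorusSite d L)).erase 0,
      Real.cos (∑ i, latticeMomentum L q i * ((z i).val : ℝ)) / dispersion (latticeMomentum L q) ^ 2) / (L : ℝ) ^ d) →
    ∀ (i j : Fin d) (z : TorusSite d L), z ≠ 0 →
      |G (z + Pi.single i 1) - G (z + Pi.single i 1 - Pi.single j 1) - G z + G (z - Pi.single j 1)| *
        Real.sqrt (∑ q, (((z q).valMinAbs : ℤ) : ℝ) ^ 2) ≤ C := by
  obtain ⟨C, hC⟩ := Prop7TorusGreen2HessianDecay.hessian_mul_dist_le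
  refine ⟨C, ?_⟩
  intro d hd
  subst hd
  exact hC

/-- ★ **(R5c) SUP ROW OF THE FREE BOND DIFFERENCE** from the DISPLAYED (R2) row `|G̃₂(t+eᵢ) − G̃₂(t)| ≤ C_V`: for any `Gf` written as in ✓ `Prop7GreenKernelSiteFree.exists_green_site_split_free`,
`|Gf (x+e_μ) z − Gf x z| ≤ C_V∕(4c⁴)` for all `x, μ, z` (the `y_c` terms cancel; the argument pair is `t, t + e_μ` with `t = EK z − EK(x+e_μ)`). [cite: Balaban1985RegularSpaces, (1.36) p.82] -/
theorem abs_free_sub_free_le_of_grad_bound (hk : k ≤ P.m + P.K) {c : ℝ} (hc : c ≠ 0)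
    (G₂ : TorusSite P.d (P.L ^ k * P.sitesPerDir k) → ℝ) {CV : ℝ}
    (hV : ∀ (i : Fin P.d) (t : TorusSite P.d (P.L ^ k * P.sitesPerDir k)), |G₂ (t + Pi.single i 1) - G₂ t| ≤ CV)
    (Gf : Site P 0 → Site P 0 → ℝ) (y_c : Site P 0)
    (hGf : ∀ x z, Gf x z = (4 * c ^ 4)⁻¹ * (G₂ (EK hk z - EK hk x) - G₂ (EK hk z - EK hk y_c)))
    (x : Site P 0) (μ : Fin P.d) (z : Site P 0) :
    |Gf (x.shift μ) z - Gf x z| ≤ CV / (4 * c ^ 4) := by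
  have hc4 : 0 < 4 * c ^ 4 := by positivity
  have ht : (EK hk z - EK hk x : TorusSite P.d (P.L ^ k * P.sitesPerDir k)) = (EK hk z - EK hk (x.shift μ)) + Pi.single μ 1 :=
    EK_sub_eq_sub_shift_add hk z x μ
  have e1 : Gf (x.shift μ) z - Gf x z
      = -((4 * c ^ 4)⁻¹ * (G₂ ((EK hk z - EK hk (x.shift μ)) + Pi.single μ 1) - G₂ (EK hk z - EK hk (x.shift μ)))) := by
    rw [hGf, hGf, ← ht]
    ring
  rw [e1, abs_neg, abs_mul, abs_inv, abs_of_pos hc4, div_eq_inv_mul]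
  exact mul_le_mul_of_nonneg_left (hV μ _) (by positivity)

/-- ★★ **(R5c) GRADIENT ROW OF THE FREE BOND DIFFERENCE** (`d = 3`, constant uniform in `P`, `k`, `c`): for any `Gf` written as in ✓ `Prop7GreenKernelSiteFree.exists_green_site_split_free` and `z ≠ x`,
`|(Gf (x+e_μ) (z+e_ν) − Gf x (z+e_ν)) − (Gf (x+e_μ) z − Gf x z)|·√(Σ_ν′((EK z − EK x) ν′)̃²) ≤ C∕(4c⁴)` — the `z`-gradient of `V = Gf b₊ − Gf b₋` is a mixed second difference of `G̃₂` at base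
`EK z − EK b₋`, so (R3a) ✓ `hessian_mul_dist_le` applies (via `green2_hessian_mul_dist_le_of_eq`). [cite: Balaban1985RegularSpaces, (1.36) p.82] -/
theorem exists_grad_free_sub_free_const : ∃ C : ℝ, ∀ (P : Params) (_ : P.d = 3) (k : ℕ) (hk : k ≤ P.m + P.K) (c : ℝ), c ≠ 0 →
    ∀ (G₂ : TorusSite P.d (P.L ^ k * P.sitesPerDir k) → ℝ),
    (∀ t : TorusSite P.d (P.L ^ k * P.sitesPerDir k),
      G₂ t = (∑ q ∈ (univ : Finset (TorusSite P.d (P.L ^ k * P.sitesPerDir k))).erase 0,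
        Real.cos (∑ i, latticeMomentum (P.L ^ k * P.sitesPerDir k) q i * ((t i).val : ℝ))
          / dispersion (latticeMomentum (P.L ^ k * P.sitesPerDir k) q) ^ 2)
        / (((P.L ^ k * P.sitesPerDir k : ℕ) : ℝ)) ^ P.d) →
    ∀ (Gf : Site P 0 → Site P 0 → ℝ) (y_c : Site P 0),
    (∀ x z, Gf x z = (4 * c ^ 4)⁻¹ * (G₂ (EK hk z - EK hk x) - G₂ (EK hk z - EK hk y_c))) →
    ∀ (x : Site P 0) (μ : Fin P.d) (z : Site P 0) (ν : Fin P.d), z ≠ x →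
      |(Gf (x.shift μ) (z.shift ν) - Gf x (z.shift ν)) - (Gf (x.shift μ) z - Gf x z)| *
        Real.sqrt (∑ q, ((((EK hk z - EK hk x) q).valMinAbs : ℤ) : ℝ) ^ 2) ≤ C / (4 * c ^ 4) := by
  obtain ⟨C, hC⟩ := green2_hessian_mul_dist_le_of_eq
  refine ⟨C, ?_⟩
  intro P hd k hk c hc G₂ hG₂ Gf y_c hGf x μ z ν hz
  haveI : NeZero (P.L ^ k * P.sitesPerDir k) := ⟨mul_ne_zero (pow_ne_zero _ P.L_pos.ne') (P.sitesPerDir_ne_zero k)⟩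
  have hc4 : 0 < 4 * c ^ 4 := by positivity
  set s : TorusSite P.d (P.L ^ k * P.sitesPerDir k) := EK hk z - EK hk x with hs
  have hs0 : s ≠ 0 := by
    intro h; apply hz; exact (EK hk).injective (sub_eq_zero.1 h)
  have h := hC hd (P.L ^ k * P.sitesPerDir k) G₂ hG₂ ν μ s hs0
  -- the four arguments
  have hzx : (EK hk z - EK hk (x.shift μ) : TorusSite P.d (P.L ^ k * P.sitesPerDir k)) = s - Pi.single μ 1 := by
    rw [hs, EK_sub_eq_sub_shift_add hk z x μ, add_sub_cancel_right]
  have hνz : (EK hk (z.shift ν) : TorusSite P.d (P.L ^ k * P.sitesPerDir k)) = EK hk z + Pi.single ν 1 := EK_shift hk z ν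
  have hzνx : (EK hk (z.shift ν) - EK hk x : TorusSite P.d (P.L ^ k * P.sitesPerDir k)) = s + Pi.single ν 1 := by
    rw [hνz, hs]; abel
  have hzνxμ : (EK hk (z.shift ν) - EK hk (x.shift μ) : TorusSite P.d (P.L ^ k * P.sitesPerDir k)) = s + Pi.single ν 1 - Pi.single μ 1 := by
    rw [EK_sub_eq_sub_shift_add hk (z.shift ν) x μ] at hzνx
    rw [← sub_eq_iff_eq_add.2 hzνx.symm]
  have e1 : (Gf (x.shift μ) (z.shift ν) - Gf x (z.shift ν)) - (Gf (x.shift μ) z - Gf x z)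
      = -((4 * c ^ 4)⁻¹ * (G₂ (s + Pi.single ν 1) - G₂ (s + Pi.single ν 1 - Pi.single μ 1) - G₂ s + G₂ (s - Pi.single μ 1))) := by
    rw [hGf, hGf, hGf, hGf, hzνxμ, hzνx, hzx, ← hs]
    ring
  rw [e1, abs_neg, abs_mul, abs_inv, abs_of_pos hc4, mul_assoc, div_eq_inv_mul]
  exact mul_le_mul_of_nonneg_left h (by positivity)


end RowsV12

end Summit.QuantumFields.YangMills.Theorems.Prop7GreenKernelSiteRows
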